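import Summits.AnomalousDissipation.AnomalousDissipation.Theorems.SolenoidalFractalHomogenisationLagrangianStepVmodDistortedWeakIntegrand
import HarnessLib

/-!
# K1L_D (stmt-AnomalousDissipation-27980), (ℓ3-A) road A: (D-GEN) OVER THE CLASS OF RECORD `IsFrameModulation` AS TYPED (no `hGd`)
# — tenure RULING D28-15 (a), part 2/2 (prover ad-k1loc-p3 g11, `--supports 27980 --as helper`)

* **`IsDistortedPropagator.abs_inner_sub_inner_le_of_lipschitzTest_of_gradBound`** — the (D-GEN) bound `|⟪U 0 t y, ψ(t)⟫ − ⟪y, ψ(0)⟫| ≤ t·N·‖y‖`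
  (all `t ∈ [0,Tw]`, `y ∈ V2`) with `hGd ↦ |∂_yG| ≤ B` on `[0,Tw]`: the proof of p722918's `…_of_lipschitzTest` verbatim, the `hint` now from
  `integrable_weakIntegrand_lipschitzField_of_gradBound` (part 1/2);
* **`IsDistortedPropagator.abs_inner_sub_inner_le_of_lipschitzTest_frameClass`** — (D-GEN) for `IsFrameModulation θ Tw nC G` with NO regularity
  hypothesis beyond the class: reset `init`, `C¹` slices `isContDiff_one_entry`, joint continuity of the entries `continuous_uncurry_entry`, and the
  bound `grad_le` (`|∂_yG| ≤ θ·nC`); `hsol` stays the only local hypothesis (L22 §4 bytes, the future v2 field).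
`sorry`-free; NOT a proof of any block, of (M_θ), of `stub_Vmod_EHTthg`, of K1L_D or of AD; rung F-D1.A0.
-/

set_option linter.dupNamespace false

noncomputable section

namespace Summit.AnomalousDissipation.AnomalousDissipation.Theorems.SolenoidalFractalHomogenisation.LagrangianStep.CellClauseMod

open Literature.Analysis Literature.Analysis.FluidPDE Literature.Analysis.FunctionSpaces
open MeasureTheory Set Filter UnitAddTorus Function Topology
open scoped ENNReal NNReal InnerProductSpace

variable {Tw : ℝ} {𝔸 : Torus.Visc4 (Fin 3)} {b : ℝ → VF} {G : ℝ → UnitAddTorus (Fin 3) → Matrix (Fin 3) (Fin 3) ℝ}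
  {U : ℝ → ℝ → (V2 →L[ℝ] V2)}


/-- The `L²` pairing of two `L²` representatives is the inner product of their classes. -/
private theorem integral_inner_eq_inner_toLp'' {f g : VF} (hf : MemLp f 2 volume) (hg : MemLp g 2 volume) :
    ∫ x, ⟪f x, g x⟫_ℝ = ⟪hf.toLp f, hg.toLp g⟫_ℝ := by
  rw [L2.inner_def]
  exact integral_congr_ae (by
    filter_upwards [hf.coeFn_toLp, hg.coeFn_toLp] with x hx hy
    rw [hx, hy])

/-- Cauchy–Schwarz for the pairing of an `L²` representative with a field of `L²` norm at most `N`. -/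
private theorem abs_integral_inner_le_of_eLpNorm_le'' {f g : VF} (hf : MemLp f 2 volume) (hg : MemLp g 2 volume)
    {N : ℝ} (hN0 : 0 ≤ N) (hN : eLpNorm g 2 volume ≤ ENNReal.ofReal N) :
    |∫ x, ⟪f x, g x⟫_ℝ| ≤ ‖hf.toLp f‖ * N := by
  rw [integral_inner_eq_inner_toLp'' hf hg]
  refine (abs_real_inner_le_norm _ _).trans (mul_le_mul_of_nonneg_left ?_ (norm_nonneg _))
  rw [Lp.norm_toLp]
  exact ENNReal.toReal_le_of_le_ofReal hN0 hN

/-! ## §4 (D-GEN) without `hGd` -/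

set_option maxHeartbeats 1600000 in
/-- **(D-GEN) from a BOUND on `∂_yG`** (`hGd ↦ |∂_yG| ≤ B` on `[0,Tw]`): `|⟪U 0 t y, ψ(t)⟫ − ⟪y, ψ(0)⟫| ≤ t·N·‖y‖` for every `t ∈ [0,Tw]`,
`y ∈ V2` — the proof of `IsDistortedPropagator.abs_inner_sub_inner_le_of_lipschitzTest` (p722918) verbatim with the `hint` of §3.
[cite: DiPernaLions1989, §II.1 (12)–(14)] [cite: Temam1997, Ch. II §3.1–3.2, (3.2)–(3.5), Thm. 3.1] -/
theorem IsDistortedPropagator.abs_inner_sub_inner_le_of_lipschitzTest_of_gradBound (hU : IsDistortedPropagator Tw 𝔸 b G U)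
    (hsol : ∀ s, 0 ≤ s → s < Tw → ∀ (φ : VF) (hφ : MemLp φ 2 volume), Torus.IsWeaklyDivFree (Torus.distort (G s) φ) → ∃ w : ℝ → VF,
      Torus.IsWeakTensorPassiveVectorDistortedOn 0 (Tw - s) 𝔸 (fun τ => b (s + τ)) (fun τ => G (s + τ)) φ w)
    (hG0 : ∀ y, G 0 y = 1)
    (hG1 : ∀ t i j, Torus.IsContDiff 1 (fun y => G t y i j))
    (hGc : ∀ i j, Continuous (uncurry fun t y => G t y i j))
    {B : ℝ} (hGb : ∀ t ∈ Icc 0 Tw, ∀ y i j e', |Torus.partialDeriv e' (fun y => G t y i j) y| ≤ B)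
    {ψ ψ' : ℝ → VF} (hψs : ∀ t, Torus.IsSmooth (ψ t))
    (hψc : ∀ l : List (Fin 3), Continuous (uncurry fun t y => Torus.iterPartialDeriv l (ψ t) y))
    (hψL : ∃ L : ℝ, 0 ≤ L ∧ ∀ t ∈ Icc 0 Tw, ∀ s ∈ Icc 0 Tw, ∀ y, ‖ψ t y - ψ s y‖ ≤ L * |t - s|)
    (hψdiv : ∀ t, Torus.IsDivFree (Torus.distort (G t) (ψ t)))
    (hψ' : ∀ᵐ t ∂(volume.restrict (Ioo 0 Tw)), ∀ y, HasDerivAt (fun s => ψ s y) (ψ' t y) t)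
    {N : ℝ} (hN0 : 0 ≤ N)
    (hN : ∀ᵐ τ ∂(volume.restrict (Ioo 0 Tw)),
      MemLp (fun x => ψ' τ x + Torus.convect (b τ) (ψ τ) x + Torus.viscAdjVar (fun y => Torus.Visc4.conj (G τ y) 𝔸) (ψ τ) x) 2 volume ∧
      eLpNorm (fun x => ψ' τ x + Torus.convect (b τ) (ψ τ) x + Torus.viscAdjVar (fun y => Torus.Visc4.conj (G τ y) 𝔸) (ψ τ) x) 2 volume
        ≤ ENNReal.ofReal N)
    {t : ℝ} (ht : t ∈ Icc 0 Tw) (y : V2) :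
    |⟪U 0 t y, ((hψs t).memLp 2).toLp (ψ t)⟫_ℝ - ⟪y, ((hψs 0).memLp 2).toLp (ψ 0)⟫_ℝ| ≤ t * N * ‖y‖ := by
  set Ψ : ℝ → V2 := fun t => ((hψs t).memLp 2).toLp (ψ t) with hΨdef
  -- only the Leray projection of `y` is seen on both sides
  set P := (Torus.divFreeL2 (Fin 3)).starProjection with hPdef
  set y' := P y with hy'def
  have hy'w : Torus.IsWeaklyDivFree ((y' : V2) : VF) := Torus.isWeaklyDivFree_starProjection y
  have hψ0div : Torus.IsDivFree (ψ 0) := by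
    have h := hψdiv 0
    rwa [show G 0 = fun _ => (1 : Matrix (Fin 3) (Fin 3) ℝ) from funext hG0, Torus.distort_one] at h
  have hΨ0 : Ψ 0 ∈ Torus.divFreeL2 (Fin 3) :=
    (Torus.mem_divFreeL2_iff _).2 ((hψ0div.isWeaklyDivFree_holds (hψs 0)).congr_ae (MemLp.coeFn_toLp _).symm)
  have hUy : U 0 t y = U 0 t y' := hU.apply_eq_apply_starProjection_reset hG0 t y
  have hyΨ : ⟪y, Ψ 0⟫_ℝ = ⟪y', Ψ 0⟫_ℝ := by
    have h0 : ⟪y - y', Ψ 0⟫_ℝ = 0 := (Torus.divFreeL2 (Fin 3)).starProjection_inner_eq_zero y (Ψ 0) hΨ0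
    rw [inner_sub_left] at h0
    linarith
  have hny : ‖y'‖ ≤ ‖y‖ := (Torus.divFreeL2 (Fin 3)).norm_starProjection_apply_le y
  show |⟪U 0 t y, Ψ t⟫_ℝ - ⟪y, Ψ 0⟫_ℝ| ≤ t * N * ‖y‖
  rw [hUy, hyΨ]
  refine le_trans ?_ (mul_le_mul_of_nonneg_left hny (mul_nonneg ht.1 hN0))
  -- the case `Tw = 0` (then `t = 0`)
  rcases eq_or_lt_of_le (ht.1.trans ht.2) with hTw0 | hTw
  · have ht0 : t = 0 := le_antisymm (hTw0 ▸ ht.2) ht.1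
    subst ht0
    rw [hU.self_of_divFree 0 le_rfl (by linarith) y' ((isWeaklyDivFree_distort_reset_iff hG0 _).2 hy'w), sub_self, abs_zero, zero_mul, zero_mul]
  -- ONE distorted weak solution from `y'` on `[0, Tw)`, represented by `U`
  set φ : VF := ((y' : V2) : VF) with hφdef
  have hφ : MemLp φ 2 volume := Lp.memLp y'
  have hyφ : hφ.toLp φ = y' := Lp.toLp_coeFn y' hφ
  have hφG : Torus.IsWeaklyDivFree (Torus.distort (G 0) φ) := (isWeaklyDivFree_distort_reset_iff hG0 _).2 hy'w
  obtain ⟨w, hw0⟩ := hsol 0 le_rfl hTw φ hφ hφG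
  have hrep0 := hU.repr 0 le_rfl hTw φ hφ hφG w hw0
  have hrep : ∀ᵐ τ ∂(volume.restrict (Ioo 0 Tw)), ∃ hτ : MemLp (w τ) 2 volume, hτ.toLp (w τ) = U 0 τ (hφ.toLp φ) := by
    simpa only [zero_add, sub_zero] using hrep0
  have hw : Torus.IsWeakTensorPassiveVectorDistortedOn 0 Tw 𝔸 b G φ w := by simpa only [zero_add, sub_zero] using hw0
  -- the pairing identity with the admissible field `ψ` (time derivative `timeDeriv ψ = ψ'` a.e.)
  have hψ'' : ∀ᵐ τ ∂(volume.restrict (Ioo 0 Tw)), ∀ x, HasDerivAt (fun s => ψ s x) (Torus.timeDeriv ψ τ x) τ := by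
    filter_upwards [hψ'] with τ hτ x
    have e : Torus.timeDeriv ψ τ x = ψ' τ x := (hτ x).deriv
    rw [e]; exact hτ x
  have hint := integrable_weakIntegrand_lipschitzField_of_gradBound hw hψs hψc hψL hG1 hGc hGb 𝔸
  have hid := hw.ae_integral_inner_lipschitzField_eq hψs hψc hψL hψdiv hψ'' hint
  -- the bound on the integrand, a.e. in time
  set Φ : ℝ → ℝ := fun σ =>
    ∫ x, (⟪w σ x, Torus.timeDeriv ψ σ x + Torus.convect (b σ) (ψ σ) x + Torus.viscAdjVar (fun y => Torus.Visc4.conj (G σ y) 𝔸) (ψ σ) x⟫_ℝ +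
      0 * ⟪b σ x, Torus.convect (w σ) (ψ σ) x⟫_ℝ) with hΦdef
  have hΦle : ∀ᵐ σ ∂(volume.restrict (Ioo 0 Tw)), ‖Φ σ‖ ≤ N * ‖y'‖ := by
    filter_upwards [hrep, hN, hψ'] with σ hσ hNσ hdσ
    obtain ⟨hm, he⟩ := hσ
    have hd' : ∀ x, Torus.timeDeriv ψ σ x = ψ' σ x := fun x => by simp only [Torus.timeDeriv, (hdσ x).deriv]
    rw [hΦdef]
    simp only [zero_mul, add_zero, hd']
    rw [Real.norm_eq_abs]
    have h1 := abs_integral_inner_le_of_eLpNorm_le'' hm hNσ.1 hN0 hNσ.2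
    rw [he, hyφ] at h1
    calc |∫ x, ⟪w σ x, ψ' σ x + Torus.convect (b σ) (ψ σ) x + Torus.viscAdjVar (fun y => Torus.Visc4.conj (G σ y) 𝔸) (ψ σ) x⟫_ℝ|
        ≤ ‖U 0 σ y'‖ * N := h1
      _ ≤ ‖y'‖ * N := mul_le_mul_of_nonneg_right (hU.norm_le _ _ _) hN0
      _ = N * ‖y'‖ := mul_comm _ _
  -- a.e. `τ ∈ (0, Tw)`: the bound at time `τ`
  have hae : ∀ᵐ τ ∂(volume.restrict (Ioo 0 Tw)), |⟪U 0 τ y', Ψ τ⟫_ℝ - ⟪y', Ψ 0⟫_ℝ| ≤ τ * N * ‖y'‖ := by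
    filter_upwards [hrep, hid, ae_restrict_mem measurableSet_Ioo] with τ hτr hτi hτm
    obtain ⟨hm, he⟩ := hτr
    have e1 : ⟪U 0 τ y', Ψ τ⟫_ℝ = ∫ x, ⟪w τ x, ψ τ x⟫_ℝ := by
      rw [hΨdef, integral_inner_eq_inner_toLp'' hm ((hψs τ).memLp 2), he, hyφ]
    have e2 : ⟪y', Ψ 0⟫_ℝ = ∫ x, ⟪φ x, ψ 0 x⟫_ℝ := by
      rw [hΨdef, integral_inner_eq_inner_toLp'' hφ ((hψs 0).memLp 2), hyφ]
    rw [e1, e2, hτi, add_sub_cancel_left]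
    have hΦτ : ∀ᵐ σ ∂(volume.restrict (Ioc 0 τ)), ‖Φ σ‖ ≤ N * ‖y'‖ := by
      rw [← Measure.restrict_congr_set Ioo_ae_eq_Ioc]
      exact ae_restrict_of_ae_restrict_of_subset (Ioo_subset_Ioo le_rfl hτm.2.le) hΦle
    have key := norm_setIntegral_le_of_norm_le_const_ae (measure_Ioc_lt_top (a := (0:ℝ)) (b := τ)) hΦτ
    rw [Real.norm_eq_abs, Measure.real, Real.volume_Ioc, sub_zero, ENNReal.toReal_ofReal hτm.1.le] at key
    calc |∫ σ in Ioc 0 τ, Φ σ| ≤ N * ‖y'‖ * τ := key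
      _ = τ * N * ‖y'‖ := by ring
  -- every `t ∈ [0, Tw]` by continuity
  have hf : ContinuousOn (fun τ => |⟪U 0 τ y', Ψ τ⟫_ℝ - ⟪y', Ψ 0⟫_ℝ|) (Icc 0 Tw) :=
    ((hU.continuousOn_inner_toLp hTw.le hψs hψL y').sub continuousOn_const).abs
  have hg : ContinuousOn (fun τ => τ * N * ‖y'‖) (Icc 0 Tw) := ((continuous_id.mul continuous_const).mul continuous_const).continuousOn
  exact Torus.le_on_Icc_of_ae_le_of_continuousOn₂ hTw hf hg hae t ht

/-- **(D-GEN) OVER THE CLASS OF RECORD, as typed** (`IsFrameModulation θ Tw nC G`; no `hGd`): the reset, the `C¹` slices, the joint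
continuity of the entries (`IsFrameModulation.continuous_uncurry_entry`) and the bound `|∂_yG| ≤ θ·nC` (`IsModulation.grad_le`) all come from
the class; `hsol` stays a local hypothesis (L22 §4 bytes) until the v2 amendment. -/
theorem IsDistortedPropagator.abs_inner_sub_inner_le_of_lipschitzTest_frameClass {θ nC : ℝ} (hU : IsDistortedPropagator Tw 𝔸 b G U)
    (hG : IsFrameModulation θ Tw nC G)
    (hsol : ∀ s, 0 ≤ s → s < Tw → ∀ (φ : VF) (hφ : MemLp φ 2 volume), Torus.IsWeaklyDivFree (Torus.distort (G s) φ) → ∃ w : ℝ → VF,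
      Torus.IsWeakTensorPassiveVectorDistortedOn 0 (Tw - s) 𝔸 (fun τ => b (s + τ)) (fun τ => G (s + τ)) φ w)
    {ψ ψ' : ℝ → VF} (hψs : ∀ t, Torus.IsSmooth (ψ t))
    (hψc : ∀ l : List (Fin 3), Continuous (uncurry fun t y => Torus.iterPartialDeriv l (ψ t) y))
    (hψL : ∃ L : ℝ, 0 ≤ L ∧ ∀ t ∈ Icc 0 Tw, ∀ s ∈ Icc 0 Tw, ∀ y, ‖ψ t y - ψ s y‖ ≤ L * |t - s|)
    (hψdiv : ∀ t, Torus.IsDivFree (Torus.distort (G t) (ψ t)))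
    (hψ' : ∀ᵐ t ∂(volume.restrict (Ioo 0 Tw)), ∀ y, HasDerivAt (fun s => ψ s y) (ψ' t y) t)
    {N : ℝ} (hN0 : 0 ≤ N)
    (hN : ∀ᵐ τ ∂(volume.restrict (Ioo 0 Tw)),
      MemLp (fun x => ψ' τ x + Torus.convect (b τ) (ψ τ) x + Torus.viscAdjVar (fun y => Torus.Visc4.conj (G τ y) 𝔸) (ψ τ) x) 2 volume ∧
      eLpNorm (fun x => ψ' τ x + Torus.convect (b τ) (ψ τ) x + Torus.viscAdjVar (fun y => Torus.Visc4.conj (G τ y) 𝔸) (ψ τ) x) 2 volume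
        ≤ ENNReal.ofReal N)
    {t : ℝ} (ht : t ∈ Icc 0 Tw) (y : V2) :
    |⟪U 0 t y, ((hψs t).memLp 2).toLp (ψ t)⟫_ℝ - ⟪y, ((hψs 0).memLp 2).toLp (ψ 0)⟫_ℝ| ≤ t * N * ‖y‖ :=
  have hTw : 0 ≤ Tw := ht.1.trans ht.2
  hU.abs_inner_sub_inner_le_of_lipschitzTest_of_gradBound hsol hG.init (fun t i j => hG.isContDiff_one_entry hTw t i j)
    (fun i j => hG.continuous_uncurry_entry hTw i j) (fun t ht' y i j e' => hG.grad_le t ht' y i j e') hψs hψc hψL hψdiv hψ' hN0 hN ht y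

end Summit.AnomalousDissipation.AnomalousDissipation.Theorems.SolenoidalFractalHomogenisation.LagrangianStep.CellClauseMod

end
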